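import Summits.PneNP.PneNP.Theorems.RamseyUncertifiableRegularResolutionRungRestrictToInduced
import Summits.PneNP.PneNP.Theorems.RamseyUncertifiableRegularResolutionRungBanksDefs

/-!
# `RegularResolutionRung` (stmt-PneNP-9818), line `indelible-zero-banks`:
# stub `stub_restrict` — restriction of regular refutations of the unary clique CNF to induced
# subgraphs, WITH PROVENANCE of negative supports

Stub `stub_restrict` of the line's skeleton (the body of its `def Restrict : Prop`). For an induced
subgraph `e : Fin a ↪ Fin n` of a Bool-graph `adj` on `Fin n`, every REGULAR resolution refutation
`π` of `Clique(adj, k)` (`cliqueCNF n k adj`) yields a regular resolution refutation `π'` of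
`Clique(adj ∘ (e × e), k)` with at most `π.length` lines, such that every line of `π'` descends from
a line of `π` whose negative support (`negSupport`, the vertices `v` with some `¬x_{i,v}`, `i < k`,
in the clause) lies inside `range e` and has at least as many elements as the negative support of
the new line (Ben-Sasson–Wigderson 2001 §2.2 restriction of a refutation by a partial assignment,
plus a renaming; ABdRLNR arXiv:2012.09476 Fact 2.1 / 3.2; folklore).

* `exists_map_restrict_provenance` (generic in the CNFs): the sibling stub's
  `SoundPathBottleneck.exists_map_restrict_regular`
  (`RamseyUncertifiableRegularResolutionRungRestrictToInduced.lean`, itself a regularity-carrying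
  copy of the tree's `IsResRefutation.exists_map_restrict`) keeps its line map internal; it is
  re-done here with the junk axiom `C₀` as a parameter and the SHAPE of the map exposed: every new
  line is either the junk axiom `C₀` or the restriction-and-renaming `e(C|ρ)` of an UNSATISFIED
  line `C` of `π` (validity and regularity parts copied verbatim).
* The clique-specific restriction pair is the sibling crux's `RestrictRefutation.exists_restriction`
  (dead block variables `x_{i,v}`, `v ∉ range e`, are set to `false`; `x_{i,e u} ↦ x_{i,u}`;
  injective on live variables) with its clause check `RestrictRefutation.clause_transfer`; the junk
  axiom is the block-`0` clause, which has no negative literal. Provenance: an unsatisfied line has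
  no dead negative block literal, so its negative support lies inside `range e`, and `u ↦ e u` injects
  the negative support of `e(C|ρ)` into that of `C` (injectivity of the renaming on live variables).
-/

set_option linter.dupNamespace false -- Summit.PneNP.PneNP: single-conjunct summit

namespace Summit.PneNP.PneNP.Cruxes.RegularResolutionRung.IndelibleZeroBanks

open Literature.Computability.MetaComplexity Literature.Computability.Complexity
open Summit.PneNP.PneNP.Theorems.RegularResolutionRung.Negative (cliqueCNF block_mem mem_clauseFinsets)
open Summit.PneNP.PneNP.Theorems.RamseyUncertifiableResolutionUncertainty.RestrictRefutation
  (exists_restriction clause_transfer ne_nil_of_isResRefutation mem_blockClause)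
open Summit.PneNP.PneNP.Cruxes.RegularResolutionRung.SoundPathBottleneck (nodup_filterMap_of_refines)

/-! ## Generic part: restriction-and-renaming with the shape of the line map exposed -/

section Generic

variable {ν μ : Type*} [DecidableEq ν] [DecidableEq μ]

/-- **Restriction-and-renaming transfer of REGULAR refutations, with provenance.** Let
`ρ : ν → Option Bool` be a partial assignment and `e : ν → μ` a renaming injective on the variables
unassigned by `ρ`; let `C₀` be a set-clause of `ψ : CNF μ` and assume every set-clause of `φ` is either
satisfied by `ρ` or has its restriction-and-renaming `e(C|ρ)` among the set-clauses of `ψ`. Then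
every REGULAR resolution refutation `π` of `φ` yields a regular resolution refutation `π'` of `ψ` of
the same length, every line of which carries either the junk axiom `C₀` or the clause `e(C|ρ)` for
an unsatisfied line `C` of `π`. (Line map of `IsResRefutation.exists_map_restrict`: a satisfied line
becomes the junk axiom, any other line `C` becomes `e(C|ρ)`, a resolution step on an assigned pivot
becomes a weakening, indices are kept; regularity as in `exists_map_restrict_regular`.) -/
theorem exists_map_restrict_provenance {φ : CNF ν} {ψ : CNF μ} (ρ : ν → Option Bool) (e : ν → μ)
    (hinj : ∀ x y, ρ x = none → ρ y = none → e x = e y → x = y)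
    (C₀ : Finset (Literal μ)) (hC₀ : C₀ ∈ ψ.clauseFinsets)
    (hcl : ∀ C ∈ φ.clauseFinsets, SatisfiedBy ρ C ∨
      (restrictClause ρ C).image (fun l => ((e l.1, l.2) : Literal μ)) ∈ ψ.clauseFinsets)
    {π : List (ResLine ν)} (hπ : IsResRefutation φ π) (hreg : IsRegular π) :
    ∃ π' : List (ResLine μ), IsResRefutation ψ π' ∧ IsRegular π' ∧ π'.length = π.length ∧
      ∀ l' ∈ π', l'.clause = C₀ ∨ ∃ l ∈ π, ¬ SatisfiedBy ρ l.clause ∧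
        l'.clause = (restrictClause ρ l.clause).image (fun q => ((e q.1, q.2) : Literal μ)) := by
  -- adapted from `SoundPathBottleneck.exists_map_restrict_regular`
  -- (Summits/PneNP/PneNP/Theorems/RamseyUncertifiableRegularResolutionRungRestrictToInduced.lean),
  -- itself adapted from `IsResRefutation.exists_map_restrict`
  -- (Literature/Computability/MetaComplexity/ResolutionRestrictionMap.lean); the shape clause is new.
  classical
  -- the literal renaming, the rule translation and the line translation
  let ê : Literal ν → Literal μ := fun l => (e l.1, l.2)
  let TR : ResRule ν → ResRule μ := fun r =>
    match r with
    | .initial => .initial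
    | .weaken i => .weaken i
    | .resolve i j v =>
      match ρ v with
      | none => .resolve i j (e v)
      | some true => .weaken j
      | some false => .weaken i
  let T : ResLine ν → ResLine μ := fun l =>
    if SatisfiedBy ρ l.clause then ⟨C₀, .initial⟩ else ⟨(restrictClause ρ l.clause).image ê, TR l.rule⟩
  have hT_sat : ∀ l : ResLine ν, SatisfiedBy ρ l.clause → T l = ⟨C₀, .initial⟩ :=
    fun l h => if_pos h
  have hT_ns : ∀ l : ResLine ν, ¬ SatisfiedBy ρ l.clause →
      T l = ⟨(restrictClause ρ l.clause).image ê, TR l.rule⟩ := fun l h => if_neg h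
  -- validity of one translated line
  have key : ∀ (prev : List (ResLine ν)) (l : ResLine ν), IsValidResLine φ prev l →
      IsValidResLine ψ (prev.map T) (T l) := by
    intro prev l hv
    by_cases hsat : SatisfiedBy ρ l.clause
    · rw [hT_sat l hsat]
      exact hC₀
    rw [hT_ns l hsat]
    obtain ⟨C, r⟩ := l
    simp only at hsat ⊢
    cases r with
    | initial =>
      unfold IsValidResLine at hv ⊢
      rcases hcl C hv with h | h
      · exact absurd h hsat
      · exact h
    | weaken i =>
      unfold IsValidResLine at hv ⊢
      obtain ⟨hi, hsub⟩ := hv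
      have hns : ¬ SatisfiedBy ρ (prev[i]).clause := fun h => hsat (h.mono hsub)
      refine ⟨by simpa using hi, ?_⟩
      simp only [List.getElem_map]
      rw [hT_ns _ hns]
      exact Finset.image_subset_image (restrictClause_mono hsub)
    | resolve i j v =>
      unfold IsValidResLine at hv
      obtain ⟨hi, hj, hvC, hvD, hE⟩ := hv
      simp only at hE
      have hi' : i < (prev.map T).length := by simpa using hi
      have hj' : j < (prev.map T).length := by simpa using hj
      rcases hρv : ρ v with _ | _ | _
      · -- unassigned pivot: a resolution step on `e v`
        have hns₁ : ¬ SatisfiedBy ρ (prev[i]).clause :=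
          not_satisfiedBy_premise (b := true) (by rw [hE]; exact Finset.subset_union_left) hsat
            (by rw [hρv]; simp)
        have hns₂ : ¬ SatisfiedBy ρ (prev[j]).clause :=
          not_satisfiedBy_premise (b := false) (by rw [hE]; exact Finset.subset_union_right) hsat
            (by rw [hρv]; simp)
        have hTR : TR (.resolve i j v) = .resolve i j (e v) := by simp only [TR, hρv]
        rw [hTR]
        unfold IsValidResLine
        refine ⟨hi', hj', ?_, ?_, ?_⟩
        · simp only [List.getElem_map]
          rw [hT_ns _ hns₁]
          exact Finset.mem_image.2 ⟨(v, true), mem_restrictClause.2 ⟨hvC, hρv⟩, rfl⟩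
        · simp only [List.getElem_map]
          rw [hT_ns _ hns₂]
          exact Finset.mem_image.2 ⟨(v, false), mem_restrictClause.2 ⟨hvD, hρv⟩, rfl⟩
        · simp only [List.getElem_map]
          rw [hT_ns _ hns₁, hT_ns _ hns₂]
          simp only
          rw [hE, image_restrictClause_union, image_restrictClause_erase hinj _ hρv,
            image_restrictClause_erase hinj _ hρv]
      · -- `ρ v = false`: the premise `prev[i] ∋ (v, true)` is not satisfied; weaken it
        have hns₁ : ¬ SatisfiedBy ρ (prev[i]).clause :=
          not_satisfiedBy_premise (b := true) (by rw [hE]; exact Finset.subset_union_left) hsat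
            (by rw [hρv]; simp)
        have hTR : TR (.resolve i j v) = .weaken i := by simp only [TR, hρv]
        rw [hTR]
        unfold IsValidResLine
        refine ⟨hi', ?_⟩
        simp only [List.getElem_map]
        rw [hT_ns _ hns₁]
        refine Finset.image_subset_image (fun l hl => ?_)
        rw [mem_restrictClause] at hl ⊢
        refine ⟨?_, hl.2⟩
        rw [hE]
        refine Finset.mem_union_left _ (Finset.mem_erase.2 ⟨?_, hl.1⟩)
        rintro rfl
        exact absurd hl.2 (by rw [hρv]; simp)
      · -- `ρ v = true`: the premise `prev[j] ∋ (v, false)` is not satisfied; weaken it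
        have hns₂ : ¬ SatisfiedBy ρ (prev[j]).clause :=
          not_satisfiedBy_premise (b := false) (by rw [hE]; exact Finset.subset_union_right) hsat
            (by rw [hρv]; simp)
        have hTR : TR (.resolve i j v) = .weaken j := by simp only [TR, hρv]
        rw [hTR]
        unfold IsValidResLine
        refine ⟨hj', ?_⟩
        simp only [List.getElem_map]
        rw [hT_ns _ hns₂]
        refine Finset.image_subset_image (fun l hl => ?_)
        rw [mem_restrictClause] at hl ⊢
        refine ⟨?_, hl.2⟩
        rw [hE]
        refine Finset.mem_union_right _ (Finset.mem_erase.2 ⟨?_, hl.1⟩)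
        rintro rfl
        exact absurd hl.2 (by rw [hρv]; simp)
  -- REGULARITY. The translated rule has no new premises ...
  have hTR_prem : ∀ (r : ResRule ν) (b : ℕ), b ∈ (TR r).premises → b ∈ r.premises := by
    intro r b hb
    cases r with
    | initial => simp [TR, ResRule.premises] at hb
    | weaken i => simpa [TR, ResRule.premises] using hb
    | resolve i j v =>
      rcases hρv : ρ v with _ | _ | _ <;> simp [TR, hρv, ResRule.premises] at hb ⊢ <;> omega
  have hT_prem : ∀ (l : ResLine ν) (b : ℕ), b ∈ (T l).premises → b ∈ l.premises := by
    intro l b hb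
    by_cases hs : SatisfiedBy ρ l.clause
    · rw [hT_sat l hs] at hb
      simp [ResLine.premises, ResRule.premises] at hb
    · rw [hT_ns l hs] at hb
      exact hTR_prem l.rule b hb
  -- ... and its pivot, if any, is the renaming of an unassigned pivot of the original rule
  have hT_piv : ∀ (l : ResLine ν) (w : μ), (T l).rule.pivot? = some w →
      ∃ v, l.rule.pivot? = some v ∧ ρ v = none ∧ e v = w := by
    intro l w h
    by_cases hs : SatisfiedBy ρ l.clause
    · rw [hT_sat l hs] at h
      simp [ResRule.pivot?] at h
    rw [hT_ns l hs] at h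
    obtain ⟨C, r⟩ := l
    cases r with
    | initial => simp [TR, ResRule.pivot?] at h
    | weaken i => simp [TR, ResRule.pivot?] at h
    | resolve i j v =>
      refine ⟨v, rfl, ?_⟩
      rcases hρv : ρ v with _ | _ | _
      · simp only [TR, hρv, ResRule.pivot?, Option.some.injEq] at h
        exact ⟨rfl, h⟩
      · simp [TR, hρv, ResRule.pivot?] at h
      · simp [TR, hρv, ResRule.pivot?] at h
  -- hence DAG paths of `π.map T` are DAG paths of `π` ...
  have hdag : ∀ p, IsDagPath ((π.map T).map ResLine.premises) p →
      IsDagPath (π.map ResLine.premises) p := by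
    rintro p ⟨hlen, hchain⟩
    refine ⟨fun i hi => by simpa using hlen i hi, List.IsChain.imp (fun a b hab => ?_) hchain⟩
    rcases Nat.lt_or_ge a π.length with ha | ha
    · have h1 : ((π.map T).map ResLine.premises).getD a [] = (T (π[a])).premises := by
        simp [List.getD_eq_getElem?_getD, ha]
      have h2 : (π.map ResLine.premises).getD a [] = (π[a]).premises := by
        simp [List.getD_eq_getElem?_getD, ha]
      rw [h1] at hab
      rw [h2]
      exact hT_prem _ b hab
    · have h1 : ((π.map T).map ResLine.premises).getD a [] = [] := by
        simp [List.getD_eq_getElem?_getD, ha]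
      rw [h1] at hab
      simp at hab
  -- ... and the pivots along them are injectively renamed sub-lists of the original pivots
  have hregT : IsRegular (π.map T) := by
    intro p hp
    have hnd := hreg p (hdag p hp)
    unfold pivotsAlong at hnd ⊢
    refine nodup_filterMap_of_refines (P := fun v => ρ v = none) (f' := e) hinj
      (fun a w h => ?_) p hnd
    rw [List.getElem?_map] at h
    rcases hπa : π[a]? with _ | l
    · rw [hπa] at h
      simp at h
    · rw [hπa, Option.map_some, Option.bind_some] at h
      obtain ⟨v, hv, hρ, hev⟩ := hT_piv l w h
      exact ⟨v, by rw [Option.bind_some, hv], hρ, hev⟩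
  refine ⟨π.map T, ⟨?_, ?_⟩, hregT, List.length_map _, ?_⟩
  · intro k hk
    have hk' : k < π.length := by simpa using hk
    have h := key (π.take k) (π[k]) (hπ.1 k hk')
    simp only [List.getElem_map]
    rw [List.map_take] at h
    exact h
  · obtain ⟨l, hl, hle⟩ := hπ.2
    refine ⟨T l, List.mem_map.2 ⟨l, hl, rfl⟩, ?_⟩
    have hns : ¬ SatisfiedBy ρ l.clause := by rw [hle]; exact not_satisfiedBy_empty
    rw [hT_ns l hns]
    simp [hle]
  · -- SHAPE of the line map (new)
    intro l' hl'
    obtain ⟨l, hl, rfl⟩ := List.mem_map.1 hl'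
    by_cases hs : SatisfiedBy ρ l.clause
    · left
      rw [hT_sat l hs]
    · right
      exact ⟨l, hl, hs, by rw [hT_ns l hs]⟩

end Generic

/-! ## Clique-specific part: negative supports under the restriction pair -/

/-- Membership in the negative support: `v ∈ negSupport n k C` iff some `¬x_{i,v}` (`i < k`) lies in
`C`. -/
theorem mem_negSupport {n k : ℕ} {C : Finset (Literal ℕ)} {v : Fin n} :
    v ∈ negSupport n k C ↔ ∃ i < k, ((i * n + (v : ℕ), false) : Literal ℕ) ∈ C := by
  simp [negSupport]

/-- The block clause `⋁_v x_{i,v}` (as a finset) has no negative literal, hence empty negative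
support. -/
theorem negSupport_blockClause (n k i : ℕ) :
    negSupport n k (((List.finRange n).map fun v => (i * n + (v : ℕ), true)).toFinset) = ∅ := by
  refine Finset.eq_empty_of_forall_notMem fun v hv => ?_
  obtain ⟨j, -, hj⟩ := mem_negSupport.1 hv
  obtain ⟨w, hw⟩ := mem_blockClause.1 (List.mem_toFinset.1 hj)
  exact Bool.noConfusion (congrArg Prod.snd hw)

/-- The empty clause has empty negative support. -/
theorem negSupport_empty (n k : ℕ) : negSupport n k (∅ : Finset (Literal ℕ)) = ∅ :=
  Finset.card_eq_zero.1 (banks_defs_anchor n k)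

/-! ## The stub -/

/-- **stub_restrict** (folklore; Ben-Sasson–Wigderson 2001 §2.2 + renaming, with regularity and
provenance): a regular resolution refutation `π` of `Clique(adj, k)` restricts, along an induced
subgraph `e : Fin a ↪ Fin n`, to a regular resolution refutation `π'` of `Clique(adj ∘ (e × e), k)`
that is no longer, every line of which descends from a line of `π` whose negative support lies
inside `range e` and dominates the new line's negative support. `k = 0` is vacuous (no clauses,
hence no refutation); junk lines descend from the empty clause of `π`. -/
theorem stub_restrict :
    ∀ (n a k : ℕ) (adj : Fin n → Fin n → Bool) (e : Fin a ↪ Fin n) (π : List (ResLine ℕ)),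
    IsResRefutation (cliqueCNF n k adj) π → IsRegular π →
    ∃ π' : List (ResLine ℕ),
    IsResRefutation (cliqueCNF a k fun u v => adj (e u) (e v)) π' ∧ IsRegular π' ∧
    π'.length ≤ π.length ∧
    ∀ l' ∈ π', ∃ l ∈ π,
    (negSupport a k l'.clause).card ≤ (negSupport n k l.clause).card ∧
    ∀ v ∈ negSupport n k l.clause, v ∈ Set.range e := by
  intro n a k adj e π hπ hreg
  have hk : 0 < k := Nat.pos_of_ne_zero (by
    rintro rfl
    exact ne_nil_of_isResRefutation hπ (by simp [cliqueCNF]))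
  -- the junk axiom: the block-`0` clause of the induced CNF (no negative literal)
  have hC₀ : ((List.finRange a).map fun v => (0 * a + (v : ℕ), true)).toFinset ∈
      (cliqueCNF a k fun u v => adj (e u) (e v)).clauseFinsets :=
    mem_clauseFinsets (block_mem k 0 hk _)
  obtain ⟨ρ, r, hlive, hdead, hren, hinj⟩ := exists_restriction n a k e
  obtain ⟨π', hπ', hreg', hlen, hprov⟩ :=
    exists_map_restrict_provenance ρ r hinj _ hC₀ (clause_transfer adj hlive hdead hren) hπ hreg
  refine ⟨π', hπ', hreg', hlen.le, fun l' hl' => ?_⟩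
  rcases hprov l' hl' with hC | ⟨l, hl, hns, hcl⟩
  · -- a junk line: it descends from the empty clause of `π`
    obtain ⟨l, hl, hle⟩ := hπ.2
    refine ⟨l, hl, ?_, fun v hv => ?_⟩
    · rw [hC, negSupport_blockClause, hle, negSupport_empty]
      exact le_rfl
    · rw [hle, negSupport_empty] at hv
      exact absurd hv (Finset.notMem_empty v)
  · -- a genuine line `e(C|ρ)` of an unsatisfied line `C`: no dead negative literal in `C` ...
    refine ⟨l, hl, ?_, fun v hv => ?_⟩
    · -- ... and `u ↦ e u` injects the new negative support into the old one
      refine Finset.card_le_card_of_injOn (fun u => e u) (fun u hu => ?_)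
        (e.injective.injOn.mono (Set.subset_univ _))
      obtain ⟨i, hi, hmem⟩ := mem_negSupport.1 (Finset.mem_coe.1 hu)
      rw [hcl] at hmem
      obtain ⟨q, hq, hqe⟩ := Finset.mem_image.1 hmem
      obtain ⟨hqC, hρq⟩ := mem_restrictClause.1 hq
      have hq1 : r q.1 = i * a + (u : ℕ) := congrArg Prod.fst hqe
      have hq2 : q.2 = false := congrArg Prod.snd hqe
      have hlive' : ρ (i * n + ((e u : Fin n) : ℕ)) = none := (hlive i hi (e u)).2 ⟨u, rfl⟩
      have hx : q.1 = i * n + ((e u : Fin n) : ℕ) :=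
        hinj q.1 _ hρq hlive' (hq1.trans (hren i hi u).symm)
      refine Finset.mem_coe.2 (mem_negSupport.2 ⟨i, hi, ?_⟩)
      have hq' : q = ((i * n + ((e u : Fin n) : ℕ), false) : Literal ℕ) := Prod.ext hx hq2
      rw [← hq']
      exact hqC
    · obtain ⟨i, hi, hmem⟩ := mem_negSupport.1 hv
      by_contra hve
      exact hns ⟨_, hmem, hdead i hi v fun ⟨u, hu⟩ => hve ⟨u, hu⟩⟩

/-- Anchor (registered sub-goal `restrict_anchor` of stmt-PneNP-9818): the statement of
`stub_restrict` once more, verbatim (the skeleton registers `stub_restrict` through its local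
abbreviation `Restrict`; this closed form is its expansion). -/
theorem restrict_anchor :
    ∀ (n a k : ℕ) (adj : Fin n → Fin n → Bool) (e : Fin a ↪ Fin n) (π : List (ResLine ℕ)),
    IsResRefutation (cliqueCNF n k adj) π → IsRegular π →
    ∃ π' : List (ResLine ℕ),
    IsResRefutation (cliqueCNF a k fun u v => adj (e u) (e v)) π' ∧ IsRegular π' ∧
    π'.length ≤ π.length ∧
    ∀ l' ∈ π', ∃ l ∈ π,
    (negSupport a k l'.clause).card ≤ (negSupport n k l.clause).card ∧
    ∀ v ∈ negSupport n k l.clause, v ∈ Set.range e :=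
  stub_restrict

end Summit.PneNP.PneNP.Cruxes.RegularResolutionRung.IndelibleZeroBanks
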